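import Summits.QuantumFields.YangMills.Theorems.FluctuationComparisonRegPrIntLS2BetaCovWalkSumStokes
import HarnessLib

/-!
# S2β · (REG-UP) FILE A1 — «TRANSLATED COVARIANT WALK SUMS»: the word-oscillation of a bond field on the torus (in the background's transport) from
# ONE-STEP bounds, its two-point form, and the estimate that moving the base point of a covariant signed sum `Y_{U₀}(walk x w)` along a connecting
# walk `γ` costs at most `|w|·(|w| + 1 + |γ|)` one-step oscillations (architect px17 g23 01:09:54Z «(REG-UP) NAMED, holder px13»; desk №705 (4))

Cell `ym3-torus` (YM ladder rung R3 = continuum `SU(2)` Yang–Mills on the three-torus at fixed lattice data — a RUNG: NOT d = 4, NOT infinite volume, NOT a mass gap,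
NOT Clay).  Width seat `ym3-torus-px13` (gen 29); crux `stmt-QuantumFields-20520`, LINE g18-1 S2β, node (REG-UP) «the tower transport of the covariant oscillation»
between (REG)@representative (✓p839270∕✓p839541, level 0) and C₇b's `hOSC` at every level.  `--kind proof --supports stmt-QuantumFields-20520 --as helper`, count-neutral,
DEFINITION-FREE (0 `def`, 0 `instance`, 0 `notation`, 0 `sorry`, default heartbeats).  TORUS-side vocabulary (`T4Continuum.walk∕walkEnd∕holAt`, lit
`BlockAveragingEMLLinearisedBackground.covWalkSum`), level-generic `j`, `SU(N)`; the transport of a matrix `Y` living at `x′` back to `x` along a walk `γ` from `x` to `x′` is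
`↑(holAt U₀ γ)·Y·star ↑(holAt U₀ γ)`.

WHAT IS PROVED (sorry-free).
§1 ONE STEP ⟹ EVERY WORD: `wordOsc_of_step` — if `‖↑(U₀⟨x,μ⟩)·F⟨x+e_μ, κ⟩·↑(U₀⟨x,μ⟩)⋆ − F⟨x,κ⟩‖ ≤ c` for all `x μ κ`, then for every base `x`, word `w`, direction `κ`:
   `‖↑(holAt U₀ (walk x w))·F⟨walkEnd x w, κ⟩·(…)⋆ − F⟨x, κ⟩‖ ≤ |w|·c` (backward letters by unitarity); `wordOsc_two_point` (two words from one base: `≤ (|w₁|+|w₂|)·c`).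
§2 ★`norm_conj_covWalkSum_translate_sub_le` — for a connecting word `γ` from `x` to `x′ = walkEnd x γ` and ANY word `w`:
   `‖↑(holAt U₀ (walk x γ))·Y_{U₀}(walk x′ w)·(…)⋆ − Y_{U₀}(walk x w)‖ ≤ |w|·((|w| + 1 + |γ|)·c)` (`Y_{U₀} = covWalkSum U₀ F`; induction on `w`, the connecting word growing by
   the back-and-forth pair `[l⁻¹] ++ γ ++ [l]` at each letter) — the engine of the one-step transport of the covariant oscillation through the linearised average `Q₁^{R₀}`
   ([Balaban1985Averaging] (124)–(125): a mean of covariant walk sums along explicit words), FILE A2.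

HONEST.  Elementary lattice gauge calculus (telescoping and re-basing of parallel transports); nothing of Bałaban's analysis is asserted or proved ([Balaban1985Averaging] (9), (58),
(124) are the printed loci of the objects); (REG-UP)'s one-step law and tower, (RES-u), (L2-TOWER), GAP♯∘ (registry 3732b7df UNTOUCHED, 0∕5), the five registered stubs, S2β, crux
20520, 19936, 19200, `YM3TorusSU2` — NOT proved; rung R3 — NOT d = 4, NOT infinite volume, NOT a mass gap, NOT Clay; the Yang–Mills mass gap is NOT proved.  Axioms standard.
-/

set_option autoImplicit false

noncomputable section

open scoped Matrix.Norms.L2Operator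

namespace Summit.QuantumFields.YangMills.Theorems.FluctuationComparisonRegPrIntLS2BetaCovariantOscillationWalkSums

open Literature.MathematicalPhysics.QuantumFieldTheory.Balaban1983to89
open T4Continuum (walk walkEnd holAt LStep holAt_nil holAt_cons Letter walk_append walkEnd_append holAt_append)
open BlockAveragingEMLLinearised (stepFactor)
open BlockAveragingEMLLinearisedBackground (covStep covWalkSum covWalkSum_cons covWalkSum_nil covWalkSum_append)
open Summit.QuantumFields.YangMills.Theorems.FluctuationComparisonRegPrIntLS2BetaCovWalkSumStokes (norm_coe_conj_le)

variable {P : Params} {j N : ℕ} [NeZero N]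

/-! ## §1 One step ⟹ every word; the two-point form -/

section Words

omit [NeZero N] in
/-- `↑(g⁻¹) = star ↑g` in `SU(N)`. [folklore] -/
theorem coe_inv_eq_star' (g : Matrix.specialUnitaryGroup (Fin N) ℂ) : (((g⁻¹ : Matrix.specialUnitaryGroup (Fin N) ℂ)) : Matrix (Fin N) (Fin N) ℂ) = star ((g : Matrix.specialUnitaryGroup (Fin N) ℂ) : Matrix (Fin N) (Fin N) ℂ) := rfl

/-- Conjugation by `↑g` is an isometry: `‖↑g·Y·(↑g)⋆ − Z‖ = ‖Y − (↑g)⋆·Z·↑g‖`. [folklore] -/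
theorem norm_conj_sub_eq_norm_sub_conj_inv (g : Matrix.specialUnitaryGroup (Fin N) ℂ) (Y Z : Matrix (Fin N) (Fin N) ℂ) :
    ‖(g : Matrix (Fin N) (Fin N) ℂ) * Y * star (g : Matrix (Fin N) (Fin N) ℂ) - Z‖ =
      ‖Y - star (g : Matrix (Fin N) (Fin N) ℂ) * Z * (g : Matrix (Fin N) (Fin N) ℂ)‖ := by
  have hu : star (g : Matrix (Fin N) (Fin N) ℂ) * (g : Matrix (Fin N) (Fin N) ℂ) = 1 := Matrix.mem_unitaryGroup_iff'.mp g.prop.1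
  have hu' : (g : Matrix (Fin N) (Fin N) ℂ) * star (g : Matrix (Fin N) (Fin N) ℂ) = 1 := Matrix.mem_unitaryGroup_iff.mp g.prop.1
  have key : (g : Matrix (Fin N) (Fin N) ℂ) * Y * star (g : Matrix (Fin N) (Fin N) ℂ) - Z =
      (g : Matrix (Fin N) (Fin N) ℂ) * (Y - star (g : Matrix (Fin N) (Fin N) ℂ) * Z * (g : Matrix (Fin N) (Fin N) ℂ)) * star (g : Matrix (Fin N) (Fin N) ℂ) := by
    have : (g : Matrix (Fin N) (Fin N) ℂ) * (star (g : Matrix (Fin N) (Fin N) ℂ) * Z * (g : Matrix (Fin N) (Fin N) ℂ)) * star (g : Matrix (Fin N) (Fin N) ℂ) = Z := by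
      calc _ = ((g : Matrix (Fin N) (Fin N) ℂ) * star (g : Matrix (Fin N) (Fin N) ℂ)) * Z * ((g : Matrix (Fin N) (Fin N) ℂ) * star (g : Matrix (Fin N) (Fin N) ℂ)) := by
            noncomm_ring
        _ = Z := by rw [hu', one_mul, mul_one]
    rw [mul_sub, sub_mul, this]
  apply le_antisymm
  · rw [key]; exact norm_coe_conj_le g _
  · have h2 : Y - star (g : Matrix (Fin N) (Fin N) ℂ) * Z * (g : Matrix (Fin N) (Fin N) ℂ) =
        (g⁻¹ : Matrix.specialUnitaryGroup (Fin N) ℂ) * ((g : Matrix (Fin N) (Fin N) ℂ) * Y * star (g : Matrix (Fin N) (Fin N) ℂ) - Z) * star ((g⁻¹ : Matrix.specialUnitaryGroup (Fin N) ℂ) : Matrix (Fin N) (Fin N) ℂ) := by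
      rw [coe_inv_eq_star', star_star]
      calc _ = (star (g : Matrix (Fin N) (Fin N) ℂ) * (g : Matrix (Fin N) (Fin N) ℂ)) * Y * (star (g : Matrix (Fin N) (Fin N) ℂ) * (g : Matrix (Fin N) (Fin N) ℂ)) -
            star (g : Matrix (Fin N) (Fin N) ℂ) * Z * (g : Matrix (Fin N) (Fin N) ℂ) := by rw [hu, one_mul, mul_one]
        _ = _ := by noncomm_ring
    rw [h2]; exact norm_coe_conj_le g⁻¹ _

/-- ★ **ONE STEP ⟹ EVERY WORD** (torus edition of ✓p839270's covariant telescoping): if every forward step moves the bond field `F` by at most `c` in the background's transport,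
`‖↑(U₀⟨x,μ⟩)·F⟨x+e_μ,κ⟩·↑(U₀⟨x,μ⟩)⋆ − F⟨x,κ⟩‖ ≤ c`, then along every word `w` from every base `x`: `‖↑(holAt U₀ (walk x w))·F⟨walkEnd x w, κ⟩·(…)⋆ − F⟨x,κ⟩‖ ≤ |w|·c`.
[cite: Balaban1985Averaging, (8)-(9) p.18; Balaban1985RegularSpaces, (1.1) p.76] -/
theorem wordOsc_of_step (U₀ : GaugeField P j (Matrix.specialUnitaryGroup (Fin N) ℂ)) (F : PBond P j → Matrix (Fin N) (Fin N) ℂ) {c : ℝ}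
    (hstep : ∀ (x : Site P j) (μ κ : Fin P.d), ‖((U₀ ⟨x, μ⟩ : Matrix.specialUnitaryGroup (Fin N) ℂ) : Matrix (Fin N) (Fin N) ℂ) * F ⟨x.shift μ, κ⟩ * star ((U₀ ⟨x, μ⟩ : Matrix.specialUnitaryGroup (Fin N) ℂ) : Matrix (Fin N) (Fin N) ℂ) - F ⟨x, κ⟩‖ ≤ c) :
    ∀ (x : Site P j) (w : List (Letter P.d)) (κ : Fin P.d),
      ‖((holAt U₀ (walk x w) : Matrix.specialUnitaryGroup (Fin N) ℂ) : Matrix (Fin N) (Fin N) ℂ) * F ⟨walkEnd x w, κ⟩ * star ((holAt U₀ (walk x w) : Matrix.specialUnitaryGroup (Fin N) ℂ) : Matrix (Fin N) (Fin N) ℂ) - F ⟨x, κ⟩‖ ≤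
        (w.length : ℝ) * c
  | x, [], κ => by simp [walk, walkEnd, holAt_nil]
  | x, (μ, b) :: w, κ => by
    have hc : 0 ≤ c := (norm_nonneg _).trans (hstep x μ κ)
    -- the generic cons step: `holAt (s :: γ) = g * holAt γ`
    have hcons : ∀ (g h : Matrix.specialUnitaryGroup (Fin N) ℂ) (Y Z W : Matrix (Fin N) (Fin N) ℂ) {a b : ℝ},
        ‖(h : Matrix (Fin N) (Fin N) ℂ) * Y * star (h : Matrix (Fin N) (Fin N) ℂ) - W‖ ≤ a →
        ‖(g : Matrix (Fin N) (Fin N) ℂ) * W * star (g : Matrix (Fin N) (Fin N) ℂ) - Z‖ ≤ b →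
        ‖((g * h : Matrix.specialUnitaryGroup (Fin N) ℂ) : Matrix (Fin N) (Fin N) ℂ) * Y * star ((g * h : Matrix.specialUnitaryGroup (Fin N) ℂ) : Matrix (Fin N) (Fin N) ℂ) - Z‖ ≤ a + b := by
      intro g h Y Z W a b h1 h2
      have e : ((g * h : Matrix.specialUnitaryGroup (Fin N) ℂ) : Matrix (Fin N) (Fin N) ℂ) * Y * star ((g * h : Matrix.specialUnitaryGroup (Fin N) ℂ) : Matrix (Fin N) (Fin N) ℂ) - Z =
          (g : Matrix (Fin N) (Fin N) ℂ) * ((h : Matrix (Fin N) (Fin N) ℂ) * Y * star (h : Matrix (Fin N) (Fin N) ℂ) - W) * star (g : Matrix (Fin N) (Fin N) ℂ) +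
            ((g : Matrix (Fin N) (Fin N) ℂ) * W * star (g : Matrix (Fin N) (Fin N) ℂ) - Z) := by
        rw [Submonoid.coe_mul, star_mul]; noncomm_ring
      rw [e]
      exact (norm_add_le _ _).trans (add_le_add ((norm_coe_conj_le g _).trans h1) h2)
    cases b with
    | true =>
      have ih := wordOsc_of_step U₀ F hstep (x.shift μ) w κ
      show ‖((holAt U₀ (⟨⟨x, μ⟩, true⟩ :: walk (x.shift μ) w) : Matrix.specialUnitaryGroup (Fin N) ℂ) : Matrix (Fin N) (Fin N) ℂ) * F ⟨walkEnd (x.shift μ) w, κ⟩ *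
          star ((holAt U₀ (⟨⟨x, μ⟩, true⟩ :: walk (x.shift μ) w) : Matrix.specialUnitaryGroup (Fin N) ℂ) : Matrix (Fin N) (Fin N) ℂ) - F ⟨x, κ⟩‖ ≤ _
      rw [holAt_cons, if_pos rfl, List.length_cons, Nat.cast_succ, add_mul, one_mul]
      exact hcons _ _ _ _ _ ih (hstep x μ κ)
    | false =>
      have ih := wordOsc_of_step U₀ F hstep (x.unshift μ) w κ
      show ‖((holAt U₀ (⟨⟨x.unshift μ, μ⟩, false⟩ :: walk (x.unshift μ) w) : Matrix.specialUnitaryGroup (Fin N) ℂ) : Matrix (Fin N) (Fin N) ℂ) * F ⟨walkEnd (x.unshift μ) w, κ⟩ *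
          star ((holAt U₀ (⟨⟨x.unshift μ, μ⟩, false⟩ :: walk (x.unshift μ) w) : Matrix.specialUnitaryGroup (Fin N) ℂ) : Matrix (Fin N) (Fin N) ℂ) - F ⟨x, κ⟩‖ ≤ _
      rw [holAt_cons, if_neg (by simp), List.length_cons, Nat.cast_succ, add_mul, one_mul]
      refine hcons _ _ _ _ _ ih ?_
      -- the backward step by unitarity: `‖g⁻¹·W·g − Z‖ = ‖W − g·Z·g⁻¹‖`, `Z = F⟨x,κ⟩`, `x = (x.unshift μ).shift μ`
      have h := hstep (x.unshift μ) μ κ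
      rw [Site.shift_unshift] at h
      rw [norm_conj_sub_eq_norm_sub_conj_inv, coe_inv_eq_star', star_star, norm_sub_rev]
      exact h

/-- **TWO WORDS FROM ONE BASE**: `‖T_x(w₁)F(end₁) − T_x(w₂)F(end₂)‖ ≤ (|w₁| + |w₂|)·c`. [cite: Balaban1985Averaging, (8)-(9) p.18] -/
theorem wordOsc_two_point (U₀ : GaugeField P j (Matrix.specialUnitaryGroup (Fin N) ℂ)) (F : PBond P j → Matrix (Fin N) (Fin N) ℂ) {c : ℝ}
    (hw : ∀ (x : Site P j) (w : List (Letter P.d)) (κ : Fin P.d),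
      ‖((holAt U₀ (walk x w) : Matrix.specialUnitaryGroup (Fin N) ℂ) : Matrix (Fin N) (Fin N) ℂ) * F ⟨walkEnd x w, κ⟩ * star ((holAt U₀ (walk x w) : Matrix.specialUnitaryGroup (Fin N) ℂ) : Matrix (Fin N) (Fin N) ℂ) - F ⟨x, κ⟩‖ ≤
        (w.length : ℝ) * c)
    (x : Site P j) (w₁ w₂ : List (Letter P.d)) (κ : Fin P.d) :
    ‖((holAt U₀ (walk x w₁) : Matrix.specialUnitaryGroup (Fin N) ℂ) : Matrix (Fin N) (Fin N) ℂ) * F ⟨walkEnd x w₁, κ⟩ * star ((holAt U₀ (walk x w₁) : Matrix.specialUnitaryGroup (Fin N) ℂ) : Matrix (Fin N) (Fin N) ℂ) -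
        ((holAt U₀ (walk x w₂) : Matrix.specialUnitaryGroup (Fin N) ℂ) : Matrix (Fin N) (Fin N) ℂ) * F ⟨walkEnd x w₂, κ⟩ * star ((holAt U₀ (walk x w₂) : Matrix.specialUnitaryGroup (Fin N) ℂ) : Matrix (Fin N) (Fin N) ℂ)‖ ≤
      ((w₁.length : ℝ) + w₂.length) * c := by
  have h1 := hw x w₁ κ
  have h2 := hw x w₂ κ
  calc _ = ‖(((holAt U₀ (walk x w₁) : Matrix.specialUnitaryGroup (Fin N) ℂ) : Matrix (Fin N) (Fin N) ℂ) * F ⟨walkEnd x w₁, κ⟩ * star ((holAt U₀ (walk x w₁) : Matrix.specialUnitaryGroup (Fin N) ℂ) : Matrix (Fin N) (Fin N) ℂ) - F ⟨x, κ⟩) -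
        (((holAt U₀ (walk x w₂) : Matrix.specialUnitaryGroup (Fin N) ℂ) : Matrix (Fin N) (Fin N) ℂ) * F ⟨walkEnd x w₂, κ⟩ * star ((holAt U₀ (walk x w₂) : Matrix.specialUnitaryGroup (Fin N) ℂ) : Matrix (Fin N) (Fin N) ℂ) - F ⟨x, κ⟩)‖ := by
          congr 1; abel
    _ ≤ _ := norm_sub_le _ _
    _ ≤ (w₁.length : ℝ) * c + (w₂.length : ℝ) * c := add_le_add h1 h2
    _ = _ := by ring

end Words

/-! ## §2 ★ Translated covariant walk sums -/

section Translate

variable (U₀ : GaugeField P j (Matrix.specialUnitaryGroup (Fin N) ℂ)) (F : PBond P j → Matrix (Fin N) (Fin N) ℂ)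

/-- One forward letter: walk, end and holonomy. [folklore] -/
theorem walk_single_true (x : Site P j) (μ : Fin P.d) : walk x [((μ, true) : Letter P.d)] = [⟨⟨x, μ⟩, true⟩] := rfl

/-- One backward letter: walk, end and holonomy. [folklore] -/
theorem walk_single_false (x : Site P j) (μ : Fin P.d) : walk x [((μ, false) : Letter P.d)] = [⟨⟨x.unshift μ, μ⟩, false⟩] := rfl

/-- `𝒰([s]) = U(s)^{±1}`. [folklore] -/
theorem holAt_single (s : LStep P j) : holAt U₀ [s] = (if s.fwd then U₀ s.bond else (U₀ s.bond)⁻¹) := by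
  rw [holAt_cons, holAt_nil, mul_one]

/-- `walk x (l :: w) = walk x [l] ++ walk (walkEnd x [l]) w`. [folklore] -/
theorem walk_cons_eq_append (x : Site P j) (l : Letter P.d) (w : List (Letter P.d)) : walk x (l :: w) = walk x [l] ++ walk (walkEnd x [l]) w := by
  rw [← walk_append]; rfl

omit [NeZero N] in
/-- Re-basing a sandwich: `G·(g′·S′·g′⋆)·G⋆ − g·S·g⋆ = g·((g⁻¹·G·g′)·S′·(g⁻¹·G·g′)⋆ − S)·g⋆`. [folklore] -/
theorem conj_conj_sub_conj_eq (G g g' : Matrix.specialUnitaryGroup (Fin N) ℂ) (S S' : Matrix (Fin N) (Fin N) ℂ) :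
    (G : Matrix (Fin N) (Fin N) ℂ) * ((g' : Matrix (Fin N) (Fin N) ℂ) * S' * star (g' : Matrix (Fin N) (Fin N) ℂ)) * star (G : Matrix (Fin N) (Fin N) ℂ) -
        (g : Matrix (Fin N) (Fin N) ℂ) * S * star (g : Matrix (Fin N) (Fin N) ℂ) =
      (g : Matrix (Fin N) (Fin N) ℂ) * (((g⁻¹ * G * g' : Matrix.specialUnitaryGroup (Fin N) ℂ) : Matrix (Fin N) (Fin N) ℂ) * S' * star ((g⁻¹ * G * g' : Matrix.specialUnitaryGroup (Fin N) ℂ) : Matrix (Fin N) (Fin N) ℂ) - S) *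
        star (g : Matrix (Fin N) (Fin N) ℂ) := by
  have hu : (g : Matrix (Fin N) (Fin N) ℂ) * star (g : Matrix (Fin N) (Fin N) ℂ) = 1 := Matrix.mem_unitaryGroup_iff.mp g.prop.1
  rw [Submonoid.coe_mul, Submonoid.coe_mul, coe_inv_eq_star', star_mul, star_mul, star_star]
  calc _ = ((g : Matrix (Fin N) (Fin N) ℂ) * star (g : Matrix (Fin N) (Fin N) ℂ)) * (G : Matrix (Fin N) (Fin N) ℂ) * (g' : Matrix (Fin N) (Fin N) ℂ) * S' *
        star (g' : Matrix (Fin N) (Fin N) ℂ) * star (G : Matrix (Fin N) (Fin N) ℂ) * ((g : Matrix (Fin N) (Fin N) ℂ) * star (g : Matrix (Fin N) (Fin N) ℂ)) -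
        (g : Matrix (Fin N) (Fin N) ℂ) * S * star (g : Matrix (Fin N) (Fin N) ℂ) := by rw [hu]; noncomm_ring
    _ = _ := by noncomm_ring

/-- ★ **TRANSLATED COVARIANT WALK SUMS**: under the word-oscillation hypothesis (every word `w′` from every base moves `F` by at most `|w′|·c` in the background's transport), moving the
base point of the covariant signed sum `Y_{U₀}(walk · w)` from `x` to `x′` along a connecting word `γ` (transporting back by `𝒰(γ)`) costs at most `|w|·(|w| + 1 + |γ|)·c`:
`‖↑𝒰(γ)·Y_{U₀}(walk x′ w)·↑𝒰(γ)⋆ − Y_{U₀}(walk x w)‖ ≤ |w|·((|w| + 1 + |γ|)·c)`.  (The `k`-th summand of `Y_{U₀}` is `F` at the `k`-th point transported back along the prefix; the two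
`k`-th points are joined by «prefix⁻¹ ++ γ ++ prefix», a word of length `≤ 2(k+1) + |γ|`.) [cite: Balaban1985Averaging, (58) p.27, (124)-(125) p.36] -/
theorem norm_conj_covWalkSum_translate_sub_le {c : ℝ}
    (hw : ∀ (x : Site P j) (w : List (Letter P.d)) (κ : Fin P.d),
      ‖((holAt U₀ (walk x w) : Matrix.specialUnitaryGroup (Fin N) ℂ) : Matrix (Fin N) (Fin N) ℂ) * F ⟨walkEnd x w, κ⟩ * star ((holAt U₀ (walk x w) : Matrix.specialUnitaryGroup (Fin N) ℂ) : Matrix (Fin N) (Fin N) ℂ) - F ⟨x, κ⟩‖ ≤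
        (w.length : ℝ) * c) :
    ∀ (w γ : List (Letter P.d)) (x : Site P j),
      ‖((holAt U₀ (walk x γ) : Matrix.specialUnitaryGroup (Fin N) ℂ) : Matrix (Fin N) (Fin N) ℂ) * covWalkSum U₀ F (walk (walkEnd x γ) w) * star ((holAt U₀ (walk x γ) : Matrix.specialUnitaryGroup (Fin N) ℂ) : Matrix (Fin N) (Fin N) ℂ) -
          covWalkSum U₀ F (walk x w)‖ ≤ (w.length : ℝ) * (((w.length : ℝ) + 1 + γ.length) * c)
  | [], γ, x => by simp [walk]
  | (μ, b) :: w, γ, x => by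
    have hc : 0 ≤ c := by
      have h := hw x [((μ, true) : Letter P.d)] μ
      simp only [List.length_singleton, Nat.cast_one, one_mul] at h
      exact (norm_nonneg _).trans h
    have h2pt := wordOsc_two_point U₀ F hw
    -- notation
    set x' : Site P j := walkEnd x γ with hx'
    set G : Matrix.specialUnitaryGroup (Fin N) ℂ := holAt U₀ (walk x γ) with hG
    cases b with
    | true =>
      -- the step data at `x` and at `x′`
      set g : Matrix.specialUnitaryGroup (Fin N) ℂ := U₀ ⟨x, μ⟩ with hg
      set g' : Matrix.specialUnitaryGroup (Fin N) ℂ := U₀ ⟨x', μ⟩ with hg'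
      set S := covWalkSum U₀ F (walk (x.shift μ) w) with hS
      set S' := covWalkSum U₀ F (walk (x'.shift μ) w) with hS'
      have e1 : covWalkSum U₀ F (walk x (((μ, true) : Letter P.d) :: w)) = F ⟨x, μ⟩ + (g : Matrix (Fin N) (Fin N) ℂ) * S * star (g : Matrix (Fin N) (Fin N) ℂ) := by
        show covWalkSum U₀ F (⟨⟨x, μ⟩, true⟩ :: walk (x.shift μ) w) = _
        rw [covWalkSum_cons]; simp [covStep, stepFactor, hg, hS]
      have e1' : covWalkSum U₀ F (walk x' (((μ, true) : Letter P.d) :: w)) = F ⟨x', μ⟩ + (g' : Matrix (Fin N) (Fin N) ℂ) * S' * star (g' : Matrix (Fin N) (Fin N) ℂ) := by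
        show covWalkSum U₀ F (⟨⟨x', μ⟩, true⟩ :: walk (x'.shift μ) w) = _
        rw [covWalkSum_cons]; simp [covStep, stepFactor, hg', hS']
      -- the connecting word one letter further: `(μ,false) :: (γ ++ [(μ,true)])` from `x + e_μ` to `x′ + e_μ`
      have hγ' : walkEnd (x.shift μ) (((μ, false) : Letter P.d) :: (γ ++ [((μ, true) : Letter P.d)])) = x'.shift μ := by
        rw [hx']
        show walkEnd ((x.shift μ).unshift μ) (γ ++ [((μ, true) : Letter P.d)]) = (walkEnd x γ).shift μ
        rw [Site.unshift_shift, walkEnd_append]; rfl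
      have hhol : holAt U₀ (walk (x.shift μ) (((μ, false) : Letter P.d) :: (γ ++ [((μ, true) : Letter P.d)]))) = g⁻¹ * G * g' := by
        rw [walk_cons_eq_append, holAt_append, walk_single_false, holAt_single]
        simp only [Bool.false_eq_true, ↓reduceIte]
        have hend : walkEnd (x.shift μ) [((μ, false) : Letter P.d)] = x := by show (x.shift μ).unshift μ = x; exact Site.unshift_shift x μ
        rw [hend, Site.unshift_shift, walk_append, holAt_append, ← hG, ← hx', walk_single_true, holAt_single]
        simp [hg, hg', mul_assoc]
      have ih := norm_conj_covWalkSum_translate_sub_le hw w (((μ, false) : Letter P.d) :: (γ ++ [((μ, true) : Letter P.d)])) (x.shift μ)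
      rw [hγ', hhol, ← hS, ← hS'] at ih
      have hlen : ((((μ, false) : Letter P.d) :: (γ ++ [((μ, true) : Letter P.d)])).length : ℝ) = γ.length + 2 := by
        simp only [List.length_cons, List.length_append, List.length_nil]; push_cast; ring
      rw [hlen] at ih
      -- the first summand: two-point form with words `γ`, `[]`
      have hfirst : ‖(G : Matrix (Fin N) (Fin N) ℂ) * F ⟨x', μ⟩ * star (G : Matrix (Fin N) (Fin N) ℂ) - F ⟨x, μ⟩‖ ≤ (γ.length : ℝ) * c := by
        have h := hw x γ μ; rwa [← hG, ← hx'] at h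
      rw [e1, e1']
      have esplit : (G : Matrix (Fin N) (Fin N) ℂ) * (F ⟨x', μ⟩ + (g' : Matrix (Fin N) (Fin N) ℂ) * S' * star (g' : Matrix (Fin N) (Fin N) ℂ)) * star (G : Matrix (Fin N) (Fin N) ℂ) -
          (F ⟨x, μ⟩ + (g : Matrix (Fin N) (Fin N) ℂ) * S * star (g : Matrix (Fin N) (Fin N) ℂ)) =
          ((G : Matrix (Fin N) (Fin N) ℂ) * F ⟨x', μ⟩ * star (G : Matrix (Fin N) (Fin N) ℂ) - F ⟨x, μ⟩) +
          ((G : Matrix (Fin N) (Fin N) ℂ) * ((g' : Matrix (Fin N) (Fin N) ℂ) * S' * star (g' : Matrix (Fin N) (Fin N) ℂ)) * star (G : Matrix (Fin N) (Fin N) ℂ) -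
            (g : Matrix (Fin N) (Fin N) ℂ) * S * star (g : Matrix (Fin N) (Fin N) ℂ)) := by noncomm_ring
      rw [esplit, conj_conj_sub_conj_eq G g g' S S']
      refine (norm_add_le _ _).trans ?_
      have hsecond := (norm_coe_conj_le g _).trans ih
      refine (add_le_add hfirst hsecond).trans ?_
      simp only [List.length_cons]; push_cast
      nlinarith [hc, Nat.cast_nonneg (α := ℝ) w.length, Nat.cast_nonneg (α := ℝ) γ.length]
    | false =>
      set y : Site P j := x.unshift μ with hy
      set y' : Site P j := x'.unshift μ with hy'
      set g : Matrix.specialUnitaryGroup (Fin N) ℂ := (U₀ ⟨y, μ⟩)⁻¹ with hg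
      set g' : Matrix.specialUnitaryGroup (Fin N) ℂ := (U₀ ⟨y', μ⟩)⁻¹ with hg'
      set S := covWalkSum U₀ F (walk y w) with hS
      set S' := covWalkSum U₀ F (walk y' w) with hS'
      have e1 : covWalkSum U₀ F (walk x (((μ, false) : Letter P.d) :: w)) =
          -((g : Matrix (Fin N) (Fin N) ℂ) * F ⟨y, μ⟩ * star (g : Matrix (Fin N) (Fin N) ℂ)) + (g : Matrix (Fin N) (Fin N) ℂ) * S * star (g : Matrix (Fin N) (Fin N) ℂ) := by
        show covWalkSum U₀ F (⟨⟨x.unshift μ, μ⟩, false⟩ :: walk (x.unshift μ) w) = _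
        rw [covWalkSum_cons]; simp [covStep, stepFactor, hg, hS, hy, coe_inv_eq_star']
      have e1' : covWalkSum U₀ F (walk x' (((μ, false) : Letter P.d) :: w)) =
          -((g' : Matrix (Fin N) (Fin N) ℂ) * F ⟨y', μ⟩ * star (g' : Matrix (Fin N) (Fin N) ℂ)) + (g' : Matrix (Fin N) (Fin N) ℂ) * S' * star (g' : Matrix (Fin N) (Fin N) ℂ) := by
        show covWalkSum U₀ F (⟨⟨x'.unshift μ, μ⟩, false⟩ :: walk (x'.unshift μ) w) = _
        rw [covWalkSum_cons]; simp [covStep, stepFactor, hg', hS', hy', coe_inv_eq_star']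
      -- the connecting word `(μ,true) :: (γ ++ [(μ,false)])` from `y` to `y′`
      have hγ' : walkEnd y (((μ, true) : Letter P.d) :: (γ ++ [((μ, false) : Letter P.d)])) = y' := by
        rw [hy', hx', hy]
        show walkEnd ((x.unshift μ).shift μ) (γ ++ [((μ, false) : Letter P.d)]) = (walkEnd x γ).unshift μ
        rw [Site.shift_unshift, walkEnd_append]; rfl
      have hhol : holAt U₀ (walk y (((μ, true) : Letter P.d) :: (γ ++ [((μ, false) : Letter P.d)]))) = g⁻¹ * G * g' := by
        rw [walk_cons_eq_append, holAt_append, walk_single_true, holAt_single]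
        simp only [↓reduceIte]
        have hend : walkEnd y [((μ, true) : Letter P.d)] = x := by show (x.unshift μ).shift μ = x; exact Site.shift_unshift x μ
        rw [hend, walk_append, holAt_append, ← hG, ← hx', walk_single_false, holAt_single]
        simp [hg, hg', hy', mul_assoc]
      have ih := norm_conj_covWalkSum_translate_sub_le hw w (((μ, true) : Letter P.d) :: (γ ++ [((μ, false) : Letter P.d)])) y
      rw [hγ', hhol, ← hS, ← hS'] at ih
      have hlen : ((((μ, true) : Letter P.d) :: (γ ++ [((μ, false) : Letter P.d)])).length : ℝ) = γ.length + 2 := by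
        simp only [List.length_cons, List.length_append, List.length_nil]; push_cast; ring
      rw [hlen] at ih
      -- the first summand: two-point form with words `γ ++ [(μ,false)]` and `[(μ,false)]` from `x`
      have hGg' : holAt U₀ (walk x (γ ++ [((μ, false) : Letter P.d)])) = G * g' := by
        rw [walk_append, holAt_append, ← hG, ← hx', walk_single_false, holAt_single]; simp [hg', hy']
      have hend1 : walkEnd x (γ ++ [((μ, false) : Letter P.d)]) = y' := by rw [walkEnd_append, ← hx']; rfl
      have hg1 : holAt U₀ (walk x [((μ, false) : Letter P.d)]) = g := by rw [walk_single_false, holAt_single]; simp [hg, hy]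
      have hend2 : walkEnd x [((μ, false) : Letter P.d)] = y := rfl
      have hfirst : ‖(G : Matrix (Fin N) (Fin N) ℂ) * ((g' : Matrix (Fin N) (Fin N) ℂ) * F ⟨y', μ⟩ * star (g' : Matrix (Fin N) (Fin N) ℂ)) * star (G : Matrix (Fin N) (Fin N) ℂ) -
          (g : Matrix (Fin N) (Fin N) ℂ) * F ⟨y, μ⟩ * star (g : Matrix (Fin N) (Fin N) ℂ)‖ ≤ ((γ.length : ℝ) + 1 + 1) * c := by
        have h := h2pt x (γ ++ [((μ, false) : Letter P.d)]) [((μ, false) : Letter P.d)] μ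
        rw [hGg', hend1, hg1, hend2, Submonoid.coe_mul, star_mul] at h
        simp only [List.length_append, List.length_singleton, Nat.cast_add, Nat.cast_one] at h
        have e : (G : Matrix (Fin N) (Fin N) ℂ) * ((g' : Matrix (Fin N) (Fin N) ℂ) * F ⟨y', μ⟩ * star (g' : Matrix (Fin N) (Fin N) ℂ)) * star (G : Matrix (Fin N) (Fin N) ℂ) =
            (G : Matrix (Fin N) (Fin N) ℂ) * (g' : Matrix (Fin N) (Fin N) ℂ) * F ⟨y', μ⟩ * (star (g' : Matrix (Fin N) (Fin N) ℂ) * star (G : Matrix (Fin N) (Fin N) ℂ)) := by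
          noncomm_ring
        rw [e]; exact h
      rw [e1, e1']
      have esplit : (G : Matrix (Fin N) (Fin N) ℂ) * (-((g' : Matrix (Fin N) (Fin N) ℂ) * F ⟨y', μ⟩ * star (g' : Matrix (Fin N) (Fin N) ℂ)) +
            (g' : Matrix (Fin N) (Fin N) ℂ) * S' * star (g' : Matrix (Fin N) (Fin N) ℂ)) * star (G : Matrix (Fin N) (Fin N) ℂ) -
          (-((g : Matrix (Fin N) (Fin N) ℂ) * F ⟨y, μ⟩ * star (g : Matrix (Fin N) (Fin N) ℂ)) + (g : Matrix (Fin N) (Fin N) ℂ) * S * star (g : Matrix (Fin N) (Fin N) ℂ)) =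
          -((G : Matrix (Fin N) (Fin N) ℂ) * ((g' : Matrix (Fin N) (Fin N) ℂ) * F ⟨y', μ⟩ * star (g' : Matrix (Fin N) (Fin N) ℂ)) * star (G : Matrix (Fin N) (Fin N) ℂ) -
            (g : Matrix (Fin N) (Fin N) ℂ) * F ⟨y, μ⟩ * star (g : Matrix (Fin N) (Fin N) ℂ)) +
          ((G : Matrix (Fin N) (Fin N) ℂ) * ((g' : Matrix (Fin N) (Fin N) ℂ) * S' * star (g' : Matrix (Fin N) (Fin N) ℂ)) * star (G : Matrix (Fin N) (Fin N) ℂ) -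
            (g : Matrix (Fin N) (Fin N) ℂ) * S * star (g : Matrix (Fin N) (Fin N) ℂ)) := by noncomm_ring
      rw [esplit, conj_conj_sub_conj_eq G g g' S S']
      refine (norm_add_le _ _).trans ?_
      rw [norm_neg]
      have hsecond := (norm_coe_conj_le g _).trans ih
      refine (add_le_add hfirst hsecond).trans ?_
      simp only [List.length_cons]; push_cast
      nlinarith [hc, Nat.cast_nonneg (α := ℝ) w.length, Nat.cast_nonneg (α := ℝ) γ.length]

end Translate

end Summit.QuantumFields.YangMills.Theorems.FluctuationComparisonRegPrIntLS2BetaCovariantOscillationWalkSums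

end
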